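import Mathlib
import Summits.MatrixMultiplication.MatrixMultiplication.Theorems.SnSubsetDichotomyHyperoctahedralThresholdStubSameColourSupply

/-!
# Product bounds for the mutual-defect configuration counts (crux `HyperoctahedralThreshold`, open core `stub_poorRigidCore`; siege k9)

Brick 5a of the dart-level bookkeeping (memo `memo-k9-dart-bookkeeping.md` §3, evidence on stmt-MatrixMultiplication-10883).  The
containers of `stub_mutualDefectsAvoiding` (p117245) are, concretely, the tuples `(P, α, α', x, x')` over `P ∉ S` and reduced words of
lengths `s, τ, u, u'` with
  `Cpp`: `P·x = P·x'` and `(P·ι_α)·x = (P·ι_α')·x'`,      `Cpq`: `P·x = (P·ι_α')·x'` and `(P·ι_α)·x = P·x'`,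
`P·ι_α := P·α⁻¹·c·α` the reflection partner.  Forgetting `α` maps `Cpp` into the based closed bi-walks
`{(P, α', x, x') : P·x = P·x'}` (the quantity `|W_τ| · CW(u,u')` of the closed-walk density (NT)) and `Cpq` into
`{(P, α', x, x') : P·x = (P·ι_α')·x'}`, with fibres of size at most the REFLECTION MULTIPLICITY
`h_s(P, Z) = #{α ∈ W_s : P·ι_α = Z}` at the point `P ∉ S` — which dart-level excision (memo §2 (B5): `S ⊇` the hot points, affordable
by POOR's second moment) caps by `H`.  Results: `card_Cpp_le`, `card_Cpq_le` and the registered `stub_configProductBounds`: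
  `|Cpp| ≤ H · #{(P,α',x,x') : P ∉ S, P·x = P·x'}`,   `|Cpq| ≤ H · #{(P,α',x,x') : P ∉ S, P·x = (P·ι_α')·x'}`.
What this does NOT do: bound the right-hand sides (that is (NT), a hypothesis on the host) or say anything in the corner `s, τ < s₁`,
where `H ≥ 1` is no saving.  Pure finite combinatorics; no definitions; reuses `foldl_act_reverse` (p112303).
-/

set_option linter.dupNamespace false

namespace Summit.MatrixMultiplication.MatrixMultiplication.Theorems.HyperoctahedralThreshold.ConfigCounts

open Finset
open Summit.MatrixMultiplication.MatrixMultiplication.Theorems.HyperoctahedralThreshold.Supply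

variable {n : ℕ}

/-- Solving for the reflection partner: `W·x = V` iff `W = V·x⁻¹`. -/
theorem eq_foldl_reverse_of_foldl_eq (μ : Fin 3 → Equiv.Perm (Fin n)) (hμ : ∀ b, μ b * μ b = 1) (x : List (Fin 3))
    {W V : Fin n} (h : x.foldl (fun v b => μ b v) W = V) : W = x.reverse.foldl (fun v b => μ b v) V := by
  rw [← h, foldl_act_reverse μ hμ]

/-- **`Cpp` by closed bi-walks × reflection multiplicity.**  `|Cpp(s,τ)| ≤ H · #{(P, α', x, x') : P ∉ S, P·x = P·x'}` whenever every
`P ∉ S` has reflection multiplicity `h_s(P, ·) ≤ H`. -/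
theorem card_Cpp_le (μ : Fin 3 → Equiv.Perm (Fin n)) (hμ : ∀ b, μ b * μ b = 1) (c : Fin 3) (S : Finset (Fin n))
    (red : ℕ → Finset (List (Fin 3))) (s τ u u' H : ℕ)
    (hH : ∀ P : Fin n, P ∉ S → ∀ Z : Fin n, ((red s).filter (fun α => ((α).reverse ++ c :: α).foldl (fun v b => μ b v) P = Z)).card ≤ H) :
    ((((Finset.univ : Finset (Fin n)).filter (fun P => P ∉ S)) ×ˢ red s ×ˢ red τ ×ˢ red u ×ˢ red u').filter (fun t => (t.2.2.2.1).foldl (fun v b => μ b v) t.1 = (t.2.2.2.2).foldl (fun v b => μ b v) t.1 ∧ (t.2.2.2.1).foldl (fun v b => μ b v) (((t.2.1).reverse ++ c :: t.2.1).foldl (fun v b => μ b v) t.1) = (t.2.2.2.2).foldl (fun v b => μ b v) (((t.2.2.1).reverse ++ c :: t.2.2.1).foldl (fun v b => μ b v) t.1))).card ≤ H * ((((Finset.univ : Finset (Fin n)).filter (fun P => P ∉ S)) ×ˢ red τ ×ˢ red u ×ˢ red u').filter (fun q => (q.2.2.1).foldl (fun v b => μ b v) q.1 = (q.2.2.2).foldl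 (fun v b => μ b v) q.1)).card := by
  set φ : (Fin n × List (Fin 3) × List (Fin 3) × List (Fin 3) × List (Fin 3)) →
      Fin n × List (Fin 3) × List (Fin 3) × List (Fin 3) := fun t => (t.1, t.2.2.1, t.2.2.2.1, t.2.2.2.2) with hφ
  refine (Finset.card_le_mul_card_image (f := φ) _ H ?_).trans (Nat.mul_le_mul_left _ (Finset.card_le_card ?_))
  · -- fibres: `α` is confined to `{α : P·ι_α = Z}`, `Z := ((P·ι_α')·x')·x⁻¹`
    intro q hq
    obtain ⟨t₀, ht₀, rfl⟩ := Finset.mem_image.1 hq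
    rw [Finset.mem_filter] at ht₀
    obtain ⟨hb, -, -⟩ := ht₀
    simp only [Finset.mem_product, Finset.mem_filter, Finset.mem_univ, true_and] at hb
    obtain ⟨hPS, -, -, -, -⟩ := hb
    refine le_trans ?_ (hH t₀.1 hPS ((t₀.2.2.2.1).reverse.foldl (fun v b => μ b v)
      ((t₀.2.2.2.2).foldl (fun v b => μ b v) (((t₀.2.2.1).reverse ++ c :: t₀.2.2.1).foldl (fun v b => μ b v) t₀.1))))
    refine Finset.card_le_card_of_injOn (fun t => t.2.1) ?_ ?_
    · intro t ht
      rw [Finset.mem_coe, Finset.mem_filter, Finset.mem_filter] at ht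
      obtain ⟨⟨hbt, -, he2⟩, hproj⟩ := ht
      simp only [hφ, Prod.mk.injEq] at hproj
      obtain ⟨h1, h3, h4, h5⟩ := hproj
      simp only [Finset.mem_product, Finset.mem_filter, Finset.mem_univ, true_and] at hbt
      obtain ⟨-, hα, -, -, -⟩ := hbt
      rw [Finset.mem_coe, Finset.mem_filter]
      refine ⟨hα, ?_⟩
      rw [← h1, ← h3, ← h4, ← h5]
      exact eq_foldl_reverse_of_foldl_eq μ hμ _ he2
    · intro t ht t' ht' htt'
      rw [Finset.mem_coe, Finset.mem_filter] at ht ht'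
      have e := ht.2.trans ht'.2.symm
      simp only [hφ, Prod.mk.injEq] at e
      obtain ⟨e1, e3, e4, e5⟩ := e
      exact Prod.ext e1 (Prod.ext htt' (Prod.ext e3 (Prod.ext e4 e5)))
  · -- image: forget `α`
    intro q hq
    obtain ⟨t, ht, rfl⟩ := Finset.mem_image.1 hq
    rw [Finset.mem_filter] at ht
    obtain ⟨hb, he1, -⟩ := ht
    simp only [Finset.mem_product, Finset.mem_filter, Finset.mem_univ, true_and] at hb
    obtain ⟨hPS, -, hα', hx, hx'⟩ := hb
    rw [Finset.mem_filter]
    simp only [hφ, Finset.mem_product, Finset.mem_filter, Finset.mem_univ, true_and]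
    exact ⟨⟨hPS, hα', hx, hx'⟩, he1⟩

/-- **`Cpq` by reversed-pair bi-walks × reflection multiplicity.**  `|Cpq(s,τ)| ≤ H · #{(P, α', x, x') : P ∉ S, P·x = (P·ι_α')·x'}`
whenever every `P ∉ S` has reflection multiplicity `h_s(P, ·) ≤ H`. -/
theorem card_Cpq_le (μ : Fin 3 → Equiv.Perm (Fin n)) (hμ : ∀ b, μ b * μ b = 1) (c : Fin 3) (S : Finset (Fin n))
    (red : ℕ → Finset (List (Fin 3))) (s τ u u' H : ℕ)
    (hH : ∀ P : Fin n, P ∉ S → ∀ Z : Fin n, ((red s).filter (fun α => ((α).reverse ++ c :: α).foldl (fun v b => μ b v) P = Z)).card ≤ H) :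
    ((((Finset.univ : Finset (Fin n)).filter (fun P => P ∉ S)) ×ˢ red s ×ˢ red τ ×ˢ red u ×ˢ red u').filter (fun t => (t.2.2.2.1).foldl (fun v b => μ b v) t.1 = (t.2.2.2.2).foldl (fun v b => μ b v) (((t.2.2.1).reverse ++ c :: t.2.2.1).foldl (fun v b => μ b v) t.1) ∧ (t.2.2.2.1).foldl (fun v b => μ b v) (((t.2.1).reverse ++ c :: t.2.1).foldl (fun v b => μ b v) t.1) = (t.2.2.2.2).foldl (fun v b => μ b v) t.1)).card ≤ H * ((((Finset.univ : Finset (Fin n)).filter (fun P => P ∉ S)) ×ˢ red τ ×ˢ red u ×ˢ red u').filter (fun q => (q.2.2.1).foldl (fun v b => μ b v) q.1 = (q.2.2.2).foldl (fun v b => μ b v) (((q.2.1).reverse ++ c :: q.2.1).foldl (fun v b => μ b v) q.1))).card := by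
  set φ : (Fin n × List (Fin 3) × List (Fin 3) × List (Fin 3) × List (Fin 3)) →
      Fin n × List (Fin 3) × List (Fin 3) × List (Fin 3) := fun t => (t.1, t.2.2.1, t.2.2.2.1, t.2.2.2.2) with hφ
  refine (Finset.card_le_mul_card_image (f := φ) _ H ?_).trans (Nat.mul_le_mul_left _ (Finset.card_le_card ?_))
  · intro q hq
    obtain ⟨t₀, ht₀, rfl⟩ := Finset.mem_image.1 hq
    rw [Finset.mem_filter] at ht₀
    obtain ⟨hb, -, -⟩ := ht₀
    simp only [Finset.mem_product, Finset.mem_filter, Finset.mem_univ, true_and] at hb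
    obtain ⟨hPS, -, -, -, -⟩ := hb
    refine le_trans ?_ (hH t₀.1 hPS ((t₀.2.2.2.1).reverse.foldl (fun v b => μ b v) ((t₀.2.2.2.2).foldl (fun v b => μ b v) t₀.1)))
    refine Finset.card_le_card_of_injOn (fun t => t.2.1) ?_ ?_
    · intro t ht
      rw [Finset.mem_coe, Finset.mem_filter, Finset.mem_filter] at ht
      obtain ⟨⟨hbt, -, he2⟩, hproj⟩ := ht
      simp only [hφ, Prod.mk.injEq] at hproj
      obtain ⟨h1, h3, h4, h5⟩ := hproj
      simp only [Finset.mem_product, Finset.mem_filter, Finset.mem_univ, true_and] at hbt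
      obtain ⟨-, hα, -, -, -⟩ := hbt
      rw [Finset.mem_coe, Finset.mem_filter]
      refine ⟨hα, ?_⟩
      rw [← h1, ← h4, ← h5]
      exact eq_foldl_reverse_of_foldl_eq μ hμ _ he2
    · intro t ht t' ht' htt'
      rw [Finset.mem_coe, Finset.mem_filter] at ht ht'
      have e := ht.2.trans ht'.2.symm
      simp only [hφ, Prod.mk.injEq] at e
      obtain ⟨e1, e3, e4, e5⟩ := e
      exact Prod.ext e1 (Prod.ext htt' (Prod.ext e3 (Prod.ext e4 e5)))
  · intro q hq
    obtain ⟨t, ht, rfl⟩ := Finset.mem_image.1 hq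
    rw [Finset.mem_filter] at ht
    obtain ⟨hb, he1, -⟩ := ht
    simp only [Finset.mem_product, Finset.mem_filter, Finset.mem_univ, true_and] at hb
    obtain ⟨hPS, -, hα', hx, hx'⟩ := hb
    rw [Finset.mem_filter]
    simp only [hφ, Finset.mem_product, Finset.mem_filter, Finset.mem_univ, true_and]
    exact ⟨⟨hPS, hα', hx, hx'⟩, he1⟩

/-- **Registered form** (`stub_configProductBounds`, a `--supports` sub-goal of crux `stmt-MatrixMultiplication-10883`, helper for
the open core `stub_poorRigidCore`): `card_Cpp_le` and `card_Cpq_le` together, fully quantified — the containers of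
`stub_mutualDefectsAvoiding` (p117245) are bounded by (reflection multiplicity off `S`) × (based closed bi-walks / reversed-pair
bi-walks), i.e. by the two host quantities the memo isolates: the hot-rung cap `H` (excisable by POOR) and the closed-walk density (NT). -/
theorem stub_configProductBounds : ∀ (n : ℕ) (μ : Fin 3 → Equiv.Perm (Fin n)), let f : Fin n → Fin 3 → Fin n := fun v b => μ b v; ∀ (c : Fin 3) (S : Finset (Fin n)) (red : ℕ → Finset (List (Fin 3))) (s τ u u' H : ℕ), (∀ b, μ b * μ b = 1) → (∀ P : Fin n, P ∉ S → ∀ Z : Fin n, ((red s).filter (fun α => ((α).reverse ++ c :: α).foldl f P = Z)).card ≤ H) → ((((Finset.univ : Finset (Fin n)).filter (fun P => P ∉ S)) ×ˢ red s ×ˢ red τ ×ˢ red u ×ˢ red u').filter (fun t => (t.2.2.2.1).foldl f t.1 = (t.2.2.2.2).foldl f t.1 ∧ (t.2.2.2.1).foldl f (((t.2.1).reverse ++ c :: t.2.1).foldl f t.1) = (t.2.2.2.2).foldl f (((t.2.2.1).reverse ++ c :: t.2.2.1).foldl f t.1))).card ≤ H * ((((Finset.univ : Finset (Fin n)).filter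 (fun P => P ∉ S)) ×ˢ red τ ×ˢ red u ×ˢ red u').filter (fun q => (q.2.2.1).foldl f q.1 = (q.2.2.2).foldl f q.1)).card ∧ ((((Finset.univ : Finset (Fin n)).filter (fun P => P ∉ S)) ×ˢ red s ×ˢ red τ ×ˢ red u ×ˢ red u').filter (fun t => (t.2.2.2.1).foldl f t.1 = (t.2.2.2.2).foldl f (((t.2.2.1).reverse ++ c :: t.2.2.1).foldl f t.1) ∧ (t.2.2.2.1).foldl f (((t.2.1).reverse ++ c :: t.2.1).foldl f t.1) = (t.2.2.2.2).foldl f t.1)).card ≤ H * ((((Finset.univ : Finset (Fin n)).filter (fun P => P ∉ S)) ×ˢ red τ ×ˢ red u ×ˢ red u').filter (fun q => (q.2.2.1).foldl f q.1 = (q.2.2.2).foldl f (((q.2.1).reverse ++ c :: q.2.1).foldl f q.1))).card := by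
  intro n μ f c S red s τ u u' H hμ hH
  exact ⟨card_Cpp_le μ hμ c S red s τ u u' H hH, card_Cpq_le μ hμ c S red s τ u u' H hH⟩

end Summit.MatrixMultiplication.MatrixMultiplication.Theorems.HyperoctahedralThreshold.ConfigCounts
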